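import Mathlib
import HarnessLib
import Literature.MathematicalPhysics.QuantumLattice.SalmhoferCutoffGevrey
import Summits.HubbardSuperconductivity.HubbardSuperconductivity.Theorems.KLProgrammeSmoothTransitionCauchyTable

/-!
# Route `KLProgramme` — engine support (cell gate-hubbard-kl, #22a (2e) «sharp χ₂ table», seat p2 g18): the Cauchy table for
# Salmhofer's cutoff, `‖χ₂^{(n)}(x)‖ ≤ (4/3)ⁿ·n!·(5·(199n/99)ⁿ·e^{−n} + 2·(15/2)ⁿ)` for ALL `n`, ALL `x`

`χ₂(x) = smoothTransition((4x−1)/3)` (`Literature/…/HubbardFreeCovariance.salmhoferCutoff`, Salmhofer 1999 (4.71)); by the affine chain rule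
`χ₂^{(n)}(x) = (4/3)ⁿ·smoothTransition^{(n)}((4/3)x − 1/3)` (`Literature.….iteratedDeriv_salmhoferCutoff`) the realistic all-orders table of
`…KLProgrammeSmoothTransitionCauchyTable.abs_iteratedDeriv_smoothTransition_le_cauchy` transfers verbatim with the factor `(4/3)ⁿ`.  This REPLACES,
for every consumer of the cutoff-table hypotheses `hXG : ∀ l ≤ Md, ∀ x, ‖iteratedFDeriv ℝ l salmhoferCutoff x‖ ≤ …` of the engine of crux
stmt-HubbardSuperconductivity-20437 (alias thresholds «(C)-B-ALIAS-L», the #22a spatial tail (2e)), the Gevrey-2 numerals `8·(l!)²·342ˡ`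
(`SalmhoferCutoffGevrey.salmhoferCutoff_gevrey_table`) by numbers within a factor `≈ 9–80` of the truth for `3 ≤ l ≤ 16` (e.g. `l = 12`:
`1.9·10²²` here vs `2.2·10²¹` true vs `4.7·10⁴⁸` Gevrey).

* **`abs_iteratedDeriv_salmhoferCutoff_le_cauchy`**, **`norm_iteratedFDeriv_salmhoferCutoff_le_cauchy`** — the closed form with `e^{−n}`;
* `norm_iteratedFDeriv_salmhoferCutoff_le_cauchy_rat` — the `e`-free form (`e^{−n} ≤ (10¹⁰/27182818283)ⁿ`);
* `salmhoferCutoff_cauchy_table` — the table shape `∀ l ≤ N, ∀ x, …` of the engine's hypotheses.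

Everything is proved; no definitions; no named facts; nothing about the model.  Numeral rows (proved and kit-certified) are tabulated in
`…KLProgrammeSalmhoferCutoffDerivTableRecord`.  References: Salmhofer 1999 §4.2.5 (4.70)–(4.71); Disertori–Rivasseau 2000 §II.2 (Gevrey cutoffs);
[cite: BenfattoGiulianiMastropietro2006] §2.2 (2.9) (smooth compact-support cutoff); Krantz–Parks 2002 Prop. 2.2.10 (Cauchy estimates).
-/

noncomputable section

namespace Summit.HubbardSuperconductivity.HubbardSuperconductivity.Theorems.KLRegimeSplit

set_option linter.dupNamespace false -- summit = problem name (single-conjunct summit), D-0017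

open Literature.MathematicalPhysics.QuantumLattice
open scoped Nat

/-- **The Cauchy table for `χ₂`**: `|χ₂^{(n)}(x)| ≤ (4/3)ⁿ·n!·(5·(199n/99)ⁿ·e^{−n} + 2·(15/2)ⁿ)` for every `n` and every `x`.
[cite: BenfattoGiulianiMastropietro2006, §2.2 (2.9)] -/
theorem abs_iteratedDeriv_salmhoferCutoff_le_cauchy (n : ℕ) (x : ℝ) :
    |iteratedDeriv n salmhoferCutoff x| ≤
      (4 / 3 : ℝ) ^ n * (n ! * (5 * ((199 / 99 : ℝ) * n) ^ n * Real.exp (-n) + 2 * (15 / 2 : ℝ) ^ n)) := by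
  rw [iteratedDeriv_salmhoferCutoff, abs_mul, abs_pow, abs_of_pos (by norm_num : (0 : ℝ) < 4 / 3)]
  exact mul_le_mul_of_nonneg_left (abs_iteratedDeriv_smoothTransition_le_cauchy n _) (by positivity)

/-- Fréchet form: `‖iteratedFDeriv ℝ n χ₂ x‖ ≤ (4/3)ⁿ·n!·(5·(199n/99)ⁿ·e^{−n} + 2·(15/2)ⁿ)`. [cite: BenfattoGiulianiMastropietro2006, §2.2 (2.9)] -/
theorem norm_iteratedFDeriv_salmhoferCutoff_le_cauchy (n : ℕ) (x : ℝ) :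
    ‖iteratedFDeriv ℝ n salmhoferCutoff x‖ ≤
      (4 / 3 : ℝ) ^ n * (n ! * (5 * ((199 / 99 : ℝ) * n) ^ n * Real.exp (-n) + 2 * (15 / 2 : ℝ) ^ n)) := by
  rw [norm_iteratedFDeriv_eq_norm_iteratedDeriv, Real.norm_eq_abs]
  exact abs_iteratedDeriv_salmhoferCutoff_le_cauchy n x

/-- The `e`-free form: `‖iteratedFDeriv ℝ n χ₂ x‖ ≤ (4/3)ⁿ·n!·(5·(199n/99)ⁿ·(10¹⁰/27182818283)ⁿ + 2·(15/2)ⁿ)` (all rationals; for numeral rows).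
[cite: BenfattoGiulianiMastropietro2006, §2.2 (2.9)] -/
theorem norm_iteratedFDeriv_salmhoferCutoff_le_cauchy_rat (n : ℕ) (x : ℝ) :
    ‖iteratedFDeriv ℝ n salmhoferCutoff x‖ ≤
      (4 / 3 : ℝ) ^ n * (n ! * (5 * ((199 / 99 : ℝ) * n) ^ n * (10000000000 / 27182818283 : ℝ) ^ n + 2 * (15 / 2 : ℝ) ^ n)) := by
  refine (norm_iteratedFDeriv_salmhoferCutoff_le_cauchy n x).trans ?_
  have he := stC_exp_neg_nat_le n
  gcongr

/-- **The table shape** of the engine's cutoff hypotheses: for any `N`, `∀ l ≤ N, ∀ x, ‖D^l χ₂(x)‖ ≤ (4/3)ˡ·l!·(5·(199l/99)ˡ·e^{−l} + 2·(15/2)ˡ)`.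
[cite: BenfattoGiulianiMastropietro2006, §2.2 (2.9)] -/
theorem salmhoferCutoff_cauchy_table (N : ℕ) :
    ∀ l ≤ N, ∀ x : ℝ, ‖iteratedFDeriv ℝ l salmhoferCutoff x‖ ≤
      (4 / 3 : ℝ) ^ l * (l ! * (5 * ((199 / 99 : ℝ) * l) ^ l * Real.exp (-l) + 2 * (15 / 2 : ℝ) ^ l)) :=
  fun l _ x => norm_iteratedFDeriv_salmhoferCutoff_le_cauchy l x

end Summit.HubbardSuperconductivity.HubbardSuperconductivity.Theorems.KLRegimeSplit

end
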